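import Summits.QuantumFields.YangMills.Theorems.UnitScaleTiltProp8LinAvgFluxExact
import HarnessLib

/-!
# Route `UnitScaleTilt`, crux K1 «MinimiserStabilityRegPr» (stmt-QuantumFields-19200) — route-R E′ (A′)-comb, COMB-FLAT-COERCIVITY sub-lemma (I3′) «δQ-SLICE», FILE F-c-1:
# **THE TRANSLATED TUBE IS THE TUBE PLUS A COARSE-GRADIENT PIECE MINUS A SLANTED FILLING** — the leg-by-leg lattice Stokes bookkeeping for the first constituent
# `tube_{B−v} − tube_B` of `δQ` (RULING №18: `δQ := ℓ(tube_block − tube_box) − D̄σ`), in the `segSum`∕`runSite` letters of ✓`LinAvgFluxExact.rect_stokes`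

Cell `ym3-torus`, width seat `ym-ust-19200-w4` (gen 8; (I3′) LOCATE-first taker, RULING №18 (2)).  THEOREMS ONLY (0 `def`, 0 `sorry`); `--supports stmt-QuantumFields-19200`,
count-neutral.  YM₃ on T³ is a ladder rung (R3), not the Clay problem; nothing here claims (I3′), COMB-FLAT-COERCIVITY, `norm_G₀ᶜ`, hcoS, E′, EX, the crux, d = 4 or the mass gap.

WHY.  FILE B (`…Prop7SliceRowOfFilling`, this seat) turned (I3′) into a FILLING CERTIFICATE for `δQ := Q_kᶜ(1)∘τ − Q_k(1)`: a real 2-chain `S_c` per coarse bond with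
`(δQ X)(c) = Σ_p S_c(p)·curl 1 X p` and `A·M·ℓ ≤ C_L`.  By px21 g6's ✓`QTw_one_eq_tube_sub_coarseGrad` the comb chart's straight part is the SAME torus tube `bondAvgIter` as the
S chart's, so after the identification `τ` (translation by `v = c_k(1,1,1)`, RULING №18 (2)) the first constituent of `δQ` is a DIFFERENCE OF TWO PARALLEL TUBES, `tube_{B−v}(c) −
tube_B(c)`: block means of straight `ℓ`-segment sums issued from `x − v` versus from `x`.  Moving a straight segment sideways by one LEG `c·e_κ` of a lattice path for `v` is
abelian Stokes on one `ℓ × c` rectangle (✓`rect_stokes`, ★p1 g18): **`A[x + ce_κ; ℓe_μ] − A[x; ℓe_μ] = (A[x + ℓe_μ; ce_κ] − A[x; ce_κ]) − Σ_{s<ℓ, t<c} A(∂p(x + se_μ + te_κ; μ, κ))`**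
(§2) — the bracket is a COARSE GRADIENT piece (the leg read at the far end of the tube minus at the near end; under the block mean it becomes `Γ(c₊) − Γ(c₋)`), the double sum is the
SLANTED STRIP filling; for `κ = μ` the strip is empty (§2, `segSum_transl_leg_self`).  §1 reads the unit plaquette circulation of ✓`rect_stokes` as the route's `curl 1 A` with its
orientation sign (`μ < κ`: `+curl⟨z, μ, κ⟩`; `κ < μ`: `−curl⟨z, κ, μ⟩`; `κ = μ`: `0`), §3 chains three legs (the stair word of `v = c₁e_{κ₁} + c₂e_{κ₂} + c₃e_{κ₃}`).  What F-c does
with it: average §3 over `x ∈ B(c₋)` (✓`blockSite_shift` moves the far-end leg terms to the block of `c₊`), divide by `ℓ` (A-units, ✓`Qk_one_toL2`), and count: each strip has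
`≤ cℓ ≤ ℓ²∕2` plaquettes, in-plane translates overlap `≤ cℓ`, `N = ℓ³` translates ⇒ by ✓p696484 `sum_sq_avg_le_of_each` the tube part of the certificate has `A_tube ≲ 3∕(2ℓ)`.
(The second constituent, the coarse gradient of the gradient-blind-making `σ = Λ_k − r₁` hierarchy, is F-c-2; see this seat's LOCATE v2.)

WHAT IS PROVED (ns `…Theorems.Prop7TranslatedTubeFilling`; any `[AddCommGroup V]` (`[Module ℝ V]` where `curl` is read), any torus `Site P j`):
* §1 `runSite_one_eq_shift`; ★`plaqCirc_eq_curl` (`μ < κ`), ★`plaqCirc_eq_neg_curl` (`κ < μ`), `plaqCirc_self` (`κ = μ`: `0`);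
* §2 ★★`segSum_transl_leg` (the displayed identity, all `μ κ`), `segSum_transl_leg_self` (`κ = μ`: `A[x + ce_μ; ℓe_μ] − A[x; ℓe_μ] = A[x + ℓe_μ; ce_μ] − A[x; ce_μ]`, no filling),
  ★`segSum_transl_leg_curl_of_lt` ∕ `…_of_gt` (the strip in `curl 1 A` letters with its sign);
* §3 ★★`segSum_transl_three_legs` — `A[x + c₁e_{κ₁} + c₂e_{κ₂} + c₃e_{κ₃}; ℓe_μ] − A[x; ℓe_μ] = (γ(x + ℓe_μ) − γ(x)) − (STRIP₁ + STRIP₂ + STRIP₃)`, `γ(w)` the three-leg path sum from `w`.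
HONEST SCOPE: identities of finite sums (abelian, linear field `A`); no estimate, no block mean, nothing of `σ`; (I3′)∕COMB-FLAT-COERCIVITY∕A6ᶜ OPEN.  Rung R3, not Clay; YM gap NOT proved.

References: T. Bałaban, CMP 95 (1984) 17–40 [Balaban1984PropagatorsI] ((1.7)–(1.9) p.19: straight contours and the rectangle identity); CMP 99 (1985) 389–434
[Balaban1985BackgroundPropagators] ((3.14) p.393, Thm 3.11 p.416: the comb averaging and the coercivity row served); CMP 98 (1985) 17–51 [Balaban1985Averaging] ((124) p.36).
-/

noncomputable section

open scoped BigOperators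

namespace Summit.QuantumFields.YangMills.Theorems.Prop7TranslatedTubeFilling

open Literature.MathematicalPhysics.QuantumFieldTheory.Balaban1983to89
open T4Continuum LatticeFieldCalculus
open B5Eq118OneStroke (runSite_add segSum_add)
open YMDAG.N18.CondIKRow (runSite_runSite_comm)
open Summit.QuantumFields.YangMills.Theorems.LinAvgFluxExact (rect_stokes)

variable {P : Params} {j : ℕ} {V : Type*} [AddCommGroup V]

/-! ## §1 The unit plaquette circulation of ✓`rect_stokes` in `curl 1 A` letters -/

/-- `x + 1·e_μ = x.shift μ`. [cite: Balaban1984PropagatorsI, (1.7) p.19] -/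
theorem runSite_one_eq_shift (z : Site P j) (μ : Fin P.d) : runSite z μ 1 = z.shift μ := by
  rw [show (1 : ℕ) = 0 + 1 from rfl, runSite_succ, runSite_zero]

/-- ★ For `μ < κ` the unit plaquette circulation `A⟨z,μ⟩ + A⟨z+e_μ,κ⟩ − A⟨z+e_κ,μ⟩ − A⟨z,κ⟩` IS the route's `curl 1 A` at the plaquette `⟨z, μ, κ⟩`.
[cite: Balaban1984PropagatorsI, (1.2) p.18, (1.9) p.19] -/
theorem plaqCirc_eq_curl [Module ℝ V] (A : VecField P j V) (z : Site P j) {μ κ : Fin P.d} (h : μ < κ) :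
    A ⟨z, μ⟩ + A ⟨runSite z μ 1, κ⟩ - A ⟨runSite z κ 1, μ⟩ - A ⟨z, κ⟩ = curl 1 A ⟨z, μ, κ, h⟩ := by
  rw [curl, one_smul, runSite_one_eq_shift, runSite_one_eq_shift]

/-- ★ For `κ < μ` it is MINUS the route's `curl 1 A` at the positively oriented plaquette `⟨z, κ, μ⟩`. [cite: Balaban1984PropagatorsI, (1.2) p.18, (1.9) p.19] -/
theorem plaqCirc_eq_neg_curl [Module ℝ V] (A : VecField P j V) (z : Site P j) {μ κ : Fin P.d} (h : κ < μ) :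
    A ⟨z, μ⟩ + A ⟨runSite z μ 1, κ⟩ - A ⟨runSite z κ 1, μ⟩ - A ⟨z, κ⟩ = -curl 1 A ⟨z, κ, μ, h⟩ := by
  rw [curl, one_smul, runSite_one_eq_shift, runSite_one_eq_shift]
  abel

/-- For `κ = μ` the "plaquette" is degenerate and its circulation vanishes. [folklore] -/
theorem plaqCirc_self (A : VecField P j V) (z : Site P j) (μ : Fin P.d) :
    A ⟨z, μ⟩ + A ⟨runSite z μ 1, μ⟩ - A ⟨runSite z μ 1, μ⟩ - A ⟨z, μ⟩ = 0 := by
  abel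

/-! ## §2 One leg: moving a straight `ℓ`-segment sideways by `c·e_κ` -/

/-- ★★ **ONE LEG.**  `A[x + ce_κ; ℓe_μ] − A[x; ℓe_μ] = (A[x + ℓe_μ; ce_κ] − A[x; ce_κ]) − Σ_{s<ℓ} Σ_{t<c} A(∂p(x + se_μ + te_κ; μ, κ))` — the translated straight segment is the
original one plus the leg read at the far end minus the leg at the near end (a coarse-gradient piece), minus the circulation around the `ℓ × c` strip between them (✓`rect_stokes`
rearranged). [cite: Balaban1984PropagatorsI, (1.9) p.19] -/
theorem segSum_transl_leg (A : VecField P j V) (x : Site P j) (μ κ : Fin P.d) (ℓ c : ℕ) :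
    segSum A (runSite x κ c) μ ℓ - segSum A x μ ℓ
      = (segSum A (runSite x μ ℓ) κ c - segSum A x κ c)
        - ∑ s ∈ Finset.range ℓ, ∑ t ∈ Finset.range c,
            (A ⟨runSite (runSite x μ s) κ t, μ⟩ + A ⟨runSite (runSite (runSite x μ s) κ t) μ 1, κ⟩
              - A ⟨runSite (runSite (runSite x μ s) κ t) κ 1, μ⟩ - A ⟨runSite (runSite x μ s) κ t, κ⟩) := by
  rw [← rect_stokes A x μ κ ℓ c]
  abel

/-- The longitudinal leg `κ = μ`: no filling — `A[x + ce_μ; ℓe_μ] − A[x; ℓe_μ] = A[x + ℓe_μ; ce_μ] − A[x; ce_μ]` (both sides are `A[x; (ℓ+c)e_μ]` split two ways).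
[cite: Balaban1984PropagatorsI, (1.8) p.19] -/
theorem segSum_transl_leg_self (A : VecField P j V) (x : Site P j) (μ : Fin P.d) (ℓ c : ℕ) :
    segSum A (runSite x μ c) μ ℓ - segSum A x μ ℓ = segSum A (runSite x μ ℓ) μ c - segSum A x μ c := by
  have h1 : segSum A x μ (c + ℓ) = segSum A x μ c + segSum A (runSite x μ c) μ ℓ := segSum_add A x μ c ℓ
  have h2 : segSum A x μ (ℓ + c) = segSum A x μ ℓ + segSum A (runSite x μ ℓ) μ c := segSum_add A x μ ℓ c
  rw [Nat.add_comm] at h2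
  rw [h1] at h2
  -- `c + ℓ`-segment split both ways
  have : segSum A (runSite x μ c) μ ℓ = segSum A x μ ℓ + segSum A (runSite x μ ℓ) μ c - segSum A x μ c := by
    rw [eq_sub_iff_add_eq, add_comm (segSum A (runSite x μ c) μ ℓ), h2]
  rw [this]
  abel

/-- ★ The strip in `curl` letters, `μ < κ`: `A[x + ce_κ; ℓe_μ] − A[x; ℓe_μ] = (A[x + ℓe_μ; ce_κ] − A[x; ce_κ]) − Σ_{s<ℓ} Σ_{t<c} curl 1 A ⟨x + se_μ + te_κ, μ, κ⟩`.
[cite: Balaban1984PropagatorsI, (1.2) p.18, (1.9) p.19] -/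
theorem segSum_transl_leg_curl_of_lt [Module ℝ V] (A : VecField P j V) (x : Site P j) {μ κ : Fin P.d} (h : μ < κ) (ℓ c : ℕ) :
    segSum A (runSite x κ c) μ ℓ - segSum A x μ ℓ
      = (segSum A (runSite x μ ℓ) κ c - segSum A x κ c)
        - ∑ s ∈ Finset.range ℓ, ∑ t ∈ Finset.range c, curl 1 A ⟨runSite (runSite x μ s) κ t, μ, κ, h⟩ := by
  rw [segSum_transl_leg]
  congr 1
  exact Finset.sum_congr rfl fun s _ => Finset.sum_congr rfl fun t _ => plaqCirc_eq_curl A _ h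

/-- ★ The strip in `curl` letters, `κ < μ`: `A[x + ce_κ; ℓe_μ] − A[x; ℓe_μ] = (A[x + ℓe_μ; ce_κ] − A[x; ce_κ]) + Σ_{s<ℓ} Σ_{t<c} curl 1 A ⟨x + se_μ + te_κ, κ, μ⟩`.
[cite: Balaban1984PropagatorsI, (1.2) p.18, (1.9) p.19] -/
theorem segSum_transl_leg_curl_of_gt [Module ℝ V] (A : VecField P j V) (x : Site P j) {μ κ : Fin P.d} (h : κ < μ) (ℓ c : ℕ) :
    segSum A (runSite x κ c) μ ℓ - segSum A x μ ℓ
      = (segSum A (runSite x μ ℓ) κ c - segSum A x κ c)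
        + ∑ s ∈ Finset.range ℓ, ∑ t ∈ Finset.range c, curl 1 A ⟨runSite (runSite x μ s) κ t, κ, μ, h⟩ := by
  rw [segSum_transl_leg, sub_eq_add_neg, ← Finset.sum_neg_distrib]
  congr 1
  refine Finset.sum_congr rfl fun s _ => ?_
  rw [← Finset.sum_neg_distrib]
  refine Finset.sum_congr rfl fun t _ => ?_
  rw [plaqCirc_eq_neg_curl A _ h, neg_neg]

/-! ## §3 Three legs: the stair word of the half-block diagonal -/

/-- ★★ **THREE LEGS.**  For the translation `v = c₁e_{κ₁} + c₂e_{κ₂} + c₃e_{κ₃}` walked as a stair (leg `i` from `x_i`, `x₀ = x`, `x_{i+1} = x_i + c_ie_{κ_i}`):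
`A[x₃; ℓe_μ] − A[x; ℓe_μ] = (γ(x + ℓe_μ) − γ(x)) − (STRIP₁ + STRIP₂ + STRIP₃)`, where `γ(w) = A[w; c₁e_{κ₁}] + A[w + c₁e_{κ₁}; c₂e_{κ₂}] + A[w + c₁e_{κ₁} + c₂e_{κ₂}; c₃e_{κ₃}]` is the
stair path sum from `w` and `STRIP_i` the `ℓ × c_i` strip circulation issued from `x_i` (§2; the far-end legs are re-based by `runSite_runSite_comm`).  Under the block mean over
`x ∈ B(c₋)` the `γ`-bracket is a coarse gradient and the strips are the slanted filling of F-c. [cite: Balaban1984PropagatorsI, (1.9) p.19; Balaban1985BackgroundPropagators, (3.14) p.393] -/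
theorem segSum_transl_three_legs (A : VecField P j V) (x : Site P j) (μ κ₁ κ₂ κ₃ : Fin P.d) (ℓ c₁ c₂ c₃ : ℕ) :
    segSum A (runSite (runSite (runSite x κ₁ c₁) κ₂ c₂) κ₃ c₃) μ ℓ - segSum A x μ ℓ
      = ((segSum A (runSite x μ ℓ) κ₁ c₁ + segSum A (runSite (runSite x μ ℓ) κ₁ c₁) κ₂ c₂
            + segSum A (runSite (runSite (runSite x μ ℓ) κ₁ c₁) κ₂ c₂) κ₃ c₃)
          - (segSum A x κ₁ c₁ + segSum A (runSite x κ₁ c₁) κ₂ c₂ + segSum A (runSite (runSite x κ₁ c₁) κ₂ c₂) κ₃ c₃))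
        - (∑ s ∈ Finset.range ℓ, ∑ t ∈ Finset.range c₁,
              (A ⟨runSite (runSite x μ s) κ₁ t, μ⟩ + A ⟨runSite (runSite (runSite x μ s) κ₁ t) μ 1, κ₁⟩
                - A ⟨runSite (runSite (runSite x μ s) κ₁ t) κ₁ 1, μ⟩ - A ⟨runSite (runSite x μ s) κ₁ t, κ₁⟩)
          + ∑ s ∈ Finset.range ℓ, ∑ t ∈ Finset.range c₂,
              (A ⟨runSite (runSite (runSite x κ₁ c₁) μ s) κ₂ t, μ⟩ + A ⟨runSite (runSite (runSite (runSite x κ₁ c₁) μ s) κ₂ t) μ 1, κ₂⟩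
                - A ⟨runSite (runSite (runSite (runSite x κ₁ c₁) μ s) κ₂ t) κ₂ 1, μ⟩ - A ⟨runSite (runSite (runSite x κ₁ c₁) μ s) κ₂ t, κ₂⟩)
          + ∑ s ∈ Finset.range ℓ, ∑ t ∈ Finset.range c₃,
              (A ⟨runSite (runSite (runSite (runSite x κ₁ c₁) κ₂ c₂) μ s) κ₃ t, μ⟩
                + A ⟨runSite (runSite (runSite (runSite (runSite x κ₁ c₁) κ₂ c₂) μ s) κ₃ t) μ 1, κ₃⟩
                - A ⟨runSite (runSite (runSite (runSite (runSite x κ₁ c₁) κ₂ c₂) μ s) κ₃ t) κ₃ 1, μ⟩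
                - A ⟨runSite (runSite (runSite (runSite x κ₁ c₁) κ₂ c₂) μ s) κ₃ t, κ₃⟩)) := by
  -- the three one-leg identities, each from its own base point
  have h1 := segSum_transl_leg A x μ κ₁ ℓ c₁
  have h2 := segSum_transl_leg A (runSite x κ₁ c₁) μ κ₂ ℓ c₂
  have h3 := segSum_transl_leg A (runSite (runSite x κ₁ c₁) κ₂ c₂) μ κ₃ ℓ c₃
  -- re-base the far-end legs: `(x + c₁e_{κ₁}) + ℓe_μ = (x + ℓe_μ) + c₁e_{κ₁}`, etc.
  rw [runSite_runSite_comm x κ₁ μ c₁ ℓ] at h2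
  rw [runSite_runSite_comm (runSite x κ₁ c₁) κ₂ μ c₂ ℓ, runSite_runSite_comm x κ₁ μ c₁ ℓ] at h3
  -- telescope
  have key : segSum A (runSite (runSite (runSite x κ₁ c₁) κ₂ c₂) κ₃ c₃) μ ℓ - segSum A x μ ℓ
      = (segSum A (runSite (runSite (runSite x κ₁ c₁) κ₂ c₂) κ₃ c₃) μ ℓ - segSum A (runSite (runSite x κ₁ c₁) κ₂ c₂) μ ℓ)
        + (segSum A (runSite (runSite x κ₁ c₁) κ₂ c₂) μ ℓ - segSum A (runSite x κ₁ c₁) μ ℓ)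
        + (segSum A (runSite x κ₁ c₁) μ ℓ - segSum A x μ ℓ) := by abel
  rw [key, h1, h2, h3]
  abel

end Summit.QuantumFields.YangMills.Theorems.Prop7TranslatedTubeFilling

end
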